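import Literature.MathematicalPhysics.QuantumFieldTheory.Balaban1983to89.B15Prop1ComplexWilsonAction
import Literature.Analysis.Calculus.ConstrainedCriticalFamilySymm
import Literature.MathematicalPhysics.QuantumFieldTheory.Balaban1983to89.B15Prop1HessianNondegenerateOfRealCoercive

/-!
# `Balaban1983to89.B15Prop1SecondVariationAlongChart` — [Balaban1989LargeFieldII] = «[LF-II]», (1.9), (1.12) p. 359 (the second variation); [Balaban1985Variational] = «[15]», Sect. G
# p. 305, p. 307:  THE REAL SECOND VARIATION OF THE WILSON ACTION ALONG CHART LINES IS THE COMPLEX HESSIAN OF THE ACTION IN COORDINATES ON REAL DIRECTIONS — the junction by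
# which the real letters (β) of the sibling lanes (second variation of `s ↦ A(exp(s p)·U₀)`) feed `hnondeg` of `B15Prop1LocalChartAtBaseField` (through `nondegenerate_of_real`)

Honest framing: statement-level skeleton of published theorems with citation tags; proofs where landed; nothing here is a claim about the
Yang–Mills mass gap.  Cell `pub-ymgap`, HUMAN RULING D-0149 (width seats), seat `pub-ymgap-dag-n12-w1` (g2; N12 = [B15]; U1a⁺ of the w1 lineage);
count-neutral; N12 NOT discharged; finite 𝕋⁴ at fixed ε; nothing continuum ∕ OS ∕ mass-gap ∕ Clay.

WHAT.  For the trace-polynomial action `A` (pointwise-characterised) and `a X = A (expMulC X ↑U₀)` on the coordinate space `PBond P 0 → ℂ³` (or on a slice `S` of it): along REAL lines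
`X = cplxVec (s p + t q)` the complex action IS the real Wilson action of the chart configuration `exp(s p + t q)·U₀` (`B15Prop1ComplexWilsonAction.actionSum_expMulC_cplxVec`), so by
the real-line calculus of `ConstrainedCriticalFamilySymm` §11 the real mixed second derivative `∂ₛ∂ₜ A(exp(s p + t q)·U₀)|₀` equals `D²a(0)(cplxVec q)(cplxVec p)` — which is REAL.
This is the reading under which a positivity statement for the real second variation on (real kernel ∩ slice) is the hypothesis `hpos` of `real_nondegenerate_of_pos`.

CONTENTS (theorems only; no `def`, no `instance`, no `sorry`).  §1 `cplxVec_line` (the two-parameter real chart line; real-linearity `cplxVec_add` ∕ `cplxVec_smul` imported from n12-w2's `B15Prop1HessianNondegenerateOfRealCoercive`).  §2 ★ `hasDerivAt_wilsonAction4_expMul_line`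
(first variation along a chart line = `Da(0) (cplxVec p)`, real part), ★★ `deriv_deriv_wilsonAction4_expMul_eq_hessian` (`∂ₛ∂ₜ|₀ A(exp(s p + t q)·U₀) = Re D²a(0)(cplxVec q)(cplxVec p)`),
`hessian_real_on_real` (`D²a(0)(cplxVec q)(cplxVec p)` is real), and the SLICE editions `…_slice` (the same for `a ∘ Subtype.val` on a conjugation-stable submodule, the `E := S` of
`exists_localChart_at_baseField`).
-/

noncomputable section

namespace Literature.MathematicalPhysics.QuantumFieldTheory.Balaban1983to89.B15Prop1SecondVariationAlongChart

open Filter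
open scoped Topology ContDiff ComplexConjugate
open Literature.Analysis.Calculus.ConstrainedCriticalFamily (deriv_deriv_along_lines fderiv_fderiv_conj_equivariant_scalar)
open Literature.Analysis.Calculus.LagrangeHessianRealCoercive (hasDerivAt_comp_realLine)
open Literature.MathematicalPhysics.QuantumFieldTheory.Balaban1983to89.Node00 (SU coeField coeField_apply)
open B15ComplexifiedDatumFamily (conjVec conjVec_cplxVec)
open B15SU2ChartHolomorphic (expMulC)
open B15Prop1StateChartSU2 (exists_conjCLM conjVec_conjVec)
open B15Prop1HessianNondegenerateOfRealCoercive (cplxVec_add cplxVec_smul)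
open B15Prop1ComplexWilsonAction (analyticAt_actionSum_expMulC actionSum_expMulC_conjVec actionSum_expMulC_cplxVec)
open B15Prop1AnalyticExtClause (cplxVec)
open B15Prop1ChartCalculusSU2 (E3)
open B15Prop1ChartSU2 (su2Chart)
open B16Sect1Backgrounds (expMul)
open T4CubeChartGnomonic (SU2)
open T4Continuum B15DeterminingSets GaugeField
open scoped Matrix.Norms.L2Operator

variable {P : Params} {j : ℕ}

/-! ## §1  The real two-parameter chart line in complex coordinates (real-linearity `cplxVec_add` ∕ `cplxVec_smul` is n12-w2's
`B15Prop1HessianNondegenerateOfRealCoercive`) -/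

/-- The real two-parameter chart line in complex coordinates: `cplxVec (s • p + t • q) = 0 + s • cplxVec p + t • cplxVec q`. [cite: Balaban1989LargeFieldI, Prop. 1 p.194 (bookkeeping)] -/
theorem cplxVec_line (s t : ℝ) (p q : VecField P j E3) :
    (0 : VecField P j (EuclideanSpace ℂ (Fin 3))) + (s : ℂ) • cplxVec p + (t : ℂ) • cplxVec q = cplxVec (s • p + t • q) := by
  rw [zero_add, cplxVec_add, cplxVec_smul, cplxVec_smul]

/-- `deriv` of a real function cast to `ℂ` is the cast of its `deriv` (whether or not it is differentiable). [folklore] -/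
private theorem deriv_ofReal_comp_eq (g : ℝ → ℝ) (t : ℝ) : deriv (fun s : ℝ => ((g s : ℝ) : ℂ)) t = ((deriv g t : ℝ) : ℂ) := by
  by_cases hg : DifferentiableAt ℝ g t
  · exact hg.hasDerivAt.ofReal_comp.deriv
  · have hng : ¬ DifferentiableAt ℝ (fun s : ℝ => ((g s : ℝ) : ℂ)) t := by
      intro h
      exact hg ((Complex.reCLM.differentiableAt.comp t h).congr_of_eventuallyEq (Eventually.of_forall fun s => by simp))
    rw [deriv_zero_of_not_differentiableAt hg, deriv_zero_of_not_differentiableAt hng, Complex.ofReal_zero]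

/-! ## §2  The real second variation along chart lines is the complex Hessian on real directions -/

section Hessian

variable {A : (PBond P j → Matrix (Fin 2) (Fin 2) ℂ) → ℂ}
  (hA : ∀ W, A W = ∑ p : Plaq P j, (1 - (W ⟨p.src, p.μ⟩ * W ⟨p.src.shift p.μ, p.ν⟩ *
    Matrix.adjugate (W ⟨p.src.shift p.ν, p.μ⟩) * Matrix.adjugate (W ⟨p.src, p.ν⟩)).trace / 2))
include hA

/-- ★ **THE FIRST VARIATION ALONG A CHART LINE**: `s ↦ A(exp(s p)·U₀)` has derivative `Re (Da(0) (cplxVec p))` at `0`, where `a X = A (expMulC X ↑U₀)` is the action in complex coordinates.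
[cite: Balaban1989LargeFieldII, (1.12) p.359; Balaban1985Variational, Sect. G p.305] -/
theorem hasDerivAt_wilsonAction4_expMul_line (U₀ : GaugeField P j SU2) (p : VecField P j E3) :
    HasDerivAt (fun s : ℝ => wilsonAction4 (expMul su2Chart (s • p) U₀))
      (fderiv ℂ (fun X : VecField P j (EuclideanSpace ℂ (Fin 3)) => A (expMulC X (coeField U₀))) 0 (cplxVec p)).re 0 := by
  have hd : DifferentiableAt ℂ (fun X : VecField P j (EuclideanSpace ℂ (Fin 3)) => A (expMulC X (coeField U₀))) 0 :=
    (analyticAt_actionSum_expMulC hA U₀ 0).differentiableAt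
  have h := hasDerivAt_comp_realLine (x₀ := (0 : VecField P j (EuclideanSpace ℂ (Fin 3)))) (cplxVec p) hd
  have hfun : (fun t : ℝ => A (expMulC ((0 : VecField P j (EuclideanSpace ℂ (Fin 3))) + (t : ℂ) • cplxVec p) (coeField U₀))) =
      fun t : ℝ => ((wilsonAction4 (expMul su2Chart (t • p) U₀) : ℝ) : ℂ) := by
    funext t
    rw [zero_add, ← cplxVec_smul, actionSum_expMulC_cplxVec hA]
  rw [hfun] at h
  have hre := (Complex.reCLM.hasFDerivAt).comp_hasDerivAt (0 : ℝ) h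
  simpa only [Function.comp_def, Complex.reCLM_apply, Complex.ofReal_re] using hre

/-- ★★ **THE REAL MIXED SECOND VARIATION ALONG CHART LINES IS THE COMPLEX HESSIAN ON REAL DIRECTIONS**:
`∂ₜ|₀ ∂ₛ|₀ A(exp(s p + t q)·U₀) = Re D²a(0)(cplxVec q)(cplxVec p)`. [cite: Balaban1989LargeFieldII, (1.9),(1.12) p.359; Balaban1985Variational, Sect. G p.305, p.307] -/
theorem deriv_deriv_wilsonAction4_expMul_eq_hessian (U₀ : GaugeField P j SU2) (p q : VecField P j E3) :
    deriv (fun t : ℝ => deriv (fun s : ℝ => wilsonAction4 (expMul su2Chart (s • p + t • q) U₀)) 0) 0 =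
      (fderiv ℂ (fderiv ℂ (fun X : VecField P j (EuclideanSpace ℂ (Fin 3)) => A (expMulC X (coeField U₀)))) 0 (cplxVec q) (cplxVec p)).re := by
  have han := analyticAt_actionSum_expMulC hA U₀ (0 : VecField P j (EuclideanSpace ℂ (Fin 3)))
  have hC := deriv_deriv_along_lines (f := fun X : VecField P j (EuclideanSpace ℂ (Fin 3)) => A (expMulC X (coeField U₀))) (x := 0)
    (n := 2) le_rfl han.contDiffAt (cplxVec p) (cplxVec q)
  -- the complex two-parameter function is the real one, cast
  have hfun : (fun t : ℝ => deriv (fun s : ℝ => A (expMulC ((0 : VecField P j (EuclideanSpace ℂ (Fin 3))) + (s : ℂ) • cplxVec p + (t : ℂ) • cplxVec q) (coeField U₀))) 0) =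
      fun t : ℝ => ((deriv (fun s : ℝ => wilsonAction4 (expMul su2Chart (s • p + t • q) U₀)) 0 : ℝ) : ℂ) := by
    funext t
    have hin : (fun s : ℝ => A (expMulC ((0 : VecField P j (EuclideanSpace ℂ (Fin 3))) + (s : ℂ) • cplxVec p + (t : ℂ) • cplxVec q) (coeField U₀))) =
        fun s : ℝ => ((wilsonAction4 (expMul su2Chart (s • p + t • q) U₀) : ℝ) : ℂ) := by
      funext s; rw [cplxVec_line, actionSum_expMulC_cplxVec hA]
    rw [hin]
    exact deriv_ofReal_comp_eq _ _
  rw [hfun, deriv_ofReal_comp_eq] at hC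
  have h := congrArg Complex.re hC
  rw [Complex.ofReal_re] at h
  exact h

/-- **THE HESSIAN IS REAL ON REAL DIRECTIONS**: `D²a(0)(cplxVec q)(cplxVec p) ∈ ℝ` (conjugation-equivariance of `a` — `actionSum_expMulC_conjVec` — at the real base `0`, `ConstrainedCriticalFamilySymm`
§10). [cite: Balaban1985Variational, p.307, (181) p.307] -/
theorem hessian_real_on_real (U₀ : GaugeField P j SU2) (p q : VecField P j E3) :
    conj (fderiv ℂ (fderiv ℂ (fun X : VecField P j (EuclideanSpace ℂ (Fin 3)) => A (expMulC X (coeField U₀)))) 0 (cplxVec q) (cplxVec p)) =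
      fderiv ℂ (fderiv ℂ (fun X : VecField P j (EuclideanSpace ℂ (Fin 3)) => A (expMulC X (coeField U₀)))) 0 (cplxVec q) (cplxVec p) := by
  obtain ⟨cE, hcE⟩ := exists_conjCLM (P := P) (j := j)
  have hcEinv : ∀ X, cE (cE X) = X := fun X => by rw [hcE, hcE, conjVec_conjVec]
  have haE : ∀ X, A (expMulC (cE X) (coeField U₀)) = conj (A (expMulC X (coeField U₀))) := fun X => by
    rw [hcE]; exact actionSum_expMulC_conjVec hA U₀ X
  have han := analyticAt_actionSum_expMulC hA U₀ (0 : VecField P j (EuclideanSpace ℂ (Fin 3)))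
  have h := fderiv_fderiv_conj_equivariant_scalar cE hcEinv haE (map_zero cE) (n := 2) le_rfl han.contDiffAt (cplxVec q) (cplxVec p)
  rw [hcE, hcE, conjVec_cplxVec, conjVec_cplxVec] at h
  exact h.symm

end Hessian

end Literature.MathematicalPhysics.QuantumFieldTheory.Balaban1983to89.B15Prop1SecondVariationAlongChart

end
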